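import Mathlib
import Literature.AlgebraicGeometry.Resolution.CobordantGame
import Summits.ResolutionOfSingularities.ResolutionOfSingularities.Theorems.WeightedInvariantLocalWeightedDropGradedSliceTransfer
import Summits.ResolutionOfSingularities.ResolutionOfSingularities.Theorems.WeightedInvariantLocalWeightedDropGradedFrobeniusLineRankOne
import Summits.ResolutionOfSingularities.ResolutionOfSingularities.Theorems.WeightedInvariantLocalWeightedDropGradedGamePropagate

/-!
# `WeightedInvariant.LocalWeightedDrop`: the TAME TRIVIALIZATION of a successor over the cylinder of its slice — tools
# (the coordinate change `Λ`: zero constants, graded, determinant `w_v·c_v`)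

Route `ResolutionOfSingularities/WeightedInvariant`, crux `LocalWeightedDrop` (stmt-ResolutionOfSingularities-8899).
[OURS · L1 W4.3] — CHAIN w43 SEAT TABLE v7 row res-type-060 «idea-1's graded slices»; tools for the tame slice theorem
(`…GradedSliceTame`, `gradedWonBy_of_slice_tame`), which supplies the trivialization demanded by
`…GradedSliceTransfer.gradedWonBy_of_slice_of_trivialization` (p513479).  The trivializing coordinate change is the orbit
substitution `sliceL` of res-type-099's orbit kit (`…OrbitQuasiInvariance`, p500270) read through `μ ↦ y_v` (frozen coordinate
`v` = last): `Λ = (s, ((1+y_v)^{wⱼ}(cⱼ + yⱼ) − cⱼ)_{j ≠ v}, c_v((1+y_v)^{w_v} − 1))`.  Nothing here is a statement of the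
manuscript under review on ladder RESOLUTION; not a verdict on card A.  AI proof, weaker than expert review.

* §1 `coeff_sliceGerm_last`, `X_last_dvd_sub_cylinder_sliceGerm` (`g ≡ (g|_{v=0}) ⊗ 1 mod y_v`),
  `subst_eq_subst_cylinder_sliceGerm` (substitutions killing `y_v` see only the slice).
* §2 `exists_eq_single_of_coeff_subst_oneVar`, `exists_inv_one_add_X` (the inverse of `1 + y_v` as a series in `y_v`).
* §3 `coeff_single_X_mul`, `coeff_single_one_add_X_pow` (linear coefficients of `(1 + y_v)^w`: `w` at `y_v`), supports.
* §4 `kappa` (`μ ↦ y_v`), `tameLambda` (`= sliceL(kappa)`) with `tameLambda_zero` / `tameLambda_succ` (explicit formula),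
  `constantCoeff_tameLambda`, `tameLambda_graded` (graded for every lattice containing `e_v` and the `e_{yⱼ}` of the translated
  coordinates — e.g. the propagated lattice), `linMat_tameLambda_*`, `det_linMat_tameLambda : det = w_v · c_v` (upper
  triangular since `v` is last); degree helpers `homDeg_one_add_X_pow`, `homDeg_X`, `homDeg_C_add_X`, `coeff_ne_zero_or_of_sub`.
-/

set_option linter.dupNamespace false -- mandated namespace of this single-conjunct summit
set_option autoImplicit false

namespace Summit.ResolutionOfSingularities.ResolutionOfSingularities.Theorems

namespace GradedGame

open MvPowerSeries
open Literature.AlgebraicGeometry.Resolution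
open Literature.AlgebraicGeometry.Resolution.FormalCoordChange (linMat)

variable {k : Type} [Field k]

/-! ## §1 The successor is the cylinder of its slice modulo the frozen coordinate -/

/-- Coefficients of the slice at the LAST coordinate, through the cylinder's exponent map. [OURS · L1 W4.3] -/
theorem coeff_sliceGerm_last {n : ℕ} (g : MvPowerSeries (Fin (n + 1 + 1)) k) (e : Fin (n + 1) →₀ ℕ) :
    coeff e (sliceGerm (Fin.last n) g) = coeff (linExp (cylExp (n + 1)) e) g := by
  rw [coeff_sliceGerm]
  have hf : ∀ l : Fin (n + 1), (Fin.last n).succ.succAbove l = Fin.castSucc l := by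
    intro l; rw [Fin.succ_last, Fin.succAbove_last]
  have hemb : e.embDomain ⟨(Fin.last n).succ.succAbove, Fin.succAbove_right_injective⟩ = linExp (cylExp (n + 1)) e := by
    ext j
    refine Fin.lastCases ?_ (fun l => ?_) j
    · rw [linExp_cylExp_last, Finsupp.embDomain_notin_range]
      rintro ⟨l, hl⟩
      simp only [Function.Embedding.coeFn_mk] at hl
      rw [hf] at hl
      exact (Fin.castSucc_lt_last l).ne hl
    · rw [linExp_cylExp_castSucc, ← hf l]
      exact Finsupp.embDomain_apply_self _ e l
  rw [hemb]

/-- **`g ≡ (g|_{v=0}) ⊗ 1 (mod v)`**: the frozen coordinate divides the difference of `g` and the cylinder of its slice.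
[OURS · L1 W4.3] -/
theorem X_last_dvd_sub_cylinder_sliceGerm {n : ℕ} (g : MvPowerSeries (Fin (n + 1 + 1)) k) :
    X (Fin.last (n + 1)) ∣ g - cylinder (sliceGerm (Fin.last n) g) := by
  rw [X_dvd_iff]
  intro d hd
  rw [map_sub, eq_linExp_cylExp_of_last_eq_zero d hd, coeff_cylinder, coeff_sliceGerm_last, sub_self]

/-- Substitutions killing the frozen coordinate see only the slice. [OURS · L1 W4.3] -/
theorem subst_eq_subst_cylinder_sliceGerm {n : ℕ} {τ : Type} (T : Fin (n + 1 + 1) → MvPowerSeries τ k) (hT : HasSubst T)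
    (hlast : T (Fin.last (n + 1)) = 0) (g : MvPowerSeries (Fin (n + 1 + 1)) k) :
    subst T g = subst T (cylinder (sliceGerm (Fin.last n) g)) := by
  obtain ⟨r, hr⟩ := X_last_dvd_sub_cylinder_sliceGerm g
  have hg : g = cylinder (sliceGerm (Fin.last n) g) + X (Fin.last (n + 1)) * r := by rw [← hr]; ring
  conv_lhs => rw [hg]
  rw [subst_add hT, subst_mul hT, subst_X hT, hlast, zero_mul, add_zero]

/-! ## §2 Series in the frozen coordinate alone -/

/-- A substitution of a one-variable series along `T ↦ y_v` has only the exponents `t·e_v`. [OURS · L1 W4.3] -/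
theorem exists_eq_single_of_coeff_subst_oneVar {M : ℕ} (v : Fin M) (φ : MvPowerSeries (Fin 1) k) (d : Fin M →₀ ℕ)
    (hd : coeff d (subst (fun _ : Fin 1 => (X v : MvPowerSeries (Fin M) k)) φ) ≠ 0) : ∃ t : ℕ, d = Finsupp.single v t := by
  classical
  have hι : HasSubst (fun _ : Fin 1 => (X v : MvPowerSeries (Fin M) k)) := hasSubst_of_constantCoeff_zero fun _ => constantCoeff_X v
  by_contra hne
  push Not at hne
  apply hd
  rw [coeff_subst hι]
  refine finsum_eq_zero_of_forall_eq_zero fun e => ?_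
  rw [Finsupp.prod_fintype _ _ (fun _ => pow_zero _), Fin.prod_univ_one, coeff_X_pow, if_neg (hne (e 0)), smul_zero]

/-- The inverse of `1 + y_v` as a series in `y_v`: `w' · (1 + y_v) = 1`, `w'(0) = 1`, exponents `t·e_v` only. [OURS · L1 W4.3] -/
theorem exists_inv_one_add_X {M : ℕ} (v : Fin M) :
    ∃ w' : MvPowerSeries (Fin M) k, w' * (1 + X v) = 1 ∧ constantCoeff w' = 1 ∧
      ∀ d, coeff d w' ≠ 0 → ∃ t : ℕ, d = Finsupp.single v t := by
  have hι : HasSubst (fun _ : Fin 1 => (X v : MvPowerSeries (Fin M) k)) := hasSubst_of_constantCoeff_zero fun _ => constantCoeff_X v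
  set ψ : MvPowerSeries (Fin 1) k := 1 + X 0 with hψ
  have hψ0 : constantCoeff ψ ≠ 0 := by simp [hψ, constantCoeff_X]
  refine ⟨subst (fun _ : Fin 1 => (X v : MvPowerSeries (Fin M) k)) ψ⁻¹, ?_, ?_, exists_eq_single_of_coeff_subst_oneVar v _⟩
  · have h1 : subst (fun _ : Fin 1 => (X v : MvPowerSeries (Fin M) k)) ψ = 1 + X v := by
      rw [hψ, subst_add hι, subst_X hι, ← coe_substAlgHom hι, map_one]
    rw [← h1, ← coe_substAlgHom hι, ← map_mul, MvPowerSeries.inv_mul_cancel _ hψ0, map_one]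
  · have h := congrArg constantCoeff (show subst (fun _ : Fin 1 => (X v : MvPowerSeries (Fin M) k)) ψ⁻¹ * (1 + X v) = 1 from ?_)
    · rw [map_mul, map_add, map_one, constantCoeff_X, add_zero, mul_one] at h
      exact h
    · have h1 : subst (fun _ : Fin 1 => (X v : MvPowerSeries (Fin M) k)) ψ = 1 + X v := by
        rw [hψ, subst_add hι, subst_X hι, ← coe_substAlgHom hι, map_one]
      rw [← h1, ← coe_substAlgHom hι, ← map_mul, MvPowerSeries.inv_mul_cancel _ hψ0, map_one]

/-! ## §3 Linear coefficients of `(1 + y_v)^w` and friends -/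

/-- `(1 + y_v)^w` is a series in `y_v`: it is the one-variable substitution of `(1 + T)^w`. [OURS · L1 W4.3] -/
theorem one_add_X_pow_eq_subst {M : ℕ} (v : Fin M) (w : ℕ) :
    ((1 + X v) ^ w : MvPowerSeries (Fin M) k) =
      subst (fun _ : Fin 1 => (X v : MvPowerSeries (Fin M) k)) ((1 + X 0) ^ w : MvPowerSeries (Fin 1) k) := by
  have hι : HasSubst (fun _ : Fin 1 => (X v : MvPowerSeries (Fin M) k)) := hasSubst_of_constantCoeff_zero fun _ => constantCoeff_X v
  rw [subst_pow hι, subst_add hι, subst_X hι, ← coe_substAlgHom hι, map_one]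

/-- Exponents of `(1 + y_v)^w` are multiples of `e_v`. [OURS · L1 W4.3] -/
theorem exists_eq_single_of_coeff_one_add_X_pow {M : ℕ} (v : Fin M) (w : ℕ) (d : Fin M →₀ ℕ)
    (hd : coeff d ((1 + X v) ^ w : MvPowerSeries (Fin M) k) ≠ 0) : ∃ t : ℕ, d = Finsupp.single v t := by
  rw [one_add_X_pow_eq_subst] at hd
  exact exists_eq_single_of_coeff_subst_oneVar v _ d hd

/-- Linear coefficients of `y_i · φ`: `[j = i] · φ(0)`. [OURS · L1 W4.3] -/
theorem coeff_single_X_mul {M : ℕ} (i j : Fin M) (φ : MvPowerSeries (Fin M) k) :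
    coeff (Finsupp.single j 1) (X i * φ) = if j = i then constantCoeff φ else 0 := by
  classical
  rw [X_def, coeff_monomial_mul]
  by_cases hji : j = i
  · subst hji
    rw [if_pos le_rfl, if_pos rfl, one_mul, tsub_self, coeff_zero_eq_constantCoeff_apply]
  · rw [if_neg, if_neg hji]
    intro hle
    have := hle i
    simp [Ne.symm hji] at this

/-- The linear coefficients of `(1 + y_v)^w`: `w` at `y_v`, `0` elsewhere. [OURS · L1 W4.3] -/
theorem coeff_single_one_add_X_pow {M : ℕ} (v j : Fin M) (w : ℕ) :
    coeff (Finsupp.single j 1) ((1 + X v) ^ w : MvPowerSeries (Fin M) k) = if j = v then (w : k) else 0 := by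
  induction w with
  | zero =>
    rw [pow_zero, coeff_one, if_neg (Finsupp.single_ne_zero.mpr one_ne_zero)]
    simp
  | succ w ih =>
    have hexp : ((1 + X v) ^ (w + 1) : MvPowerSeries (Fin M) k) = (1 + X v) ^ w + X v * (1 + X v) ^ w := by ring
    rw [hexp, map_add, ih, coeff_single_X_mul]
    have hcc : constantCoeff ((1 + X v) ^ w : MvPowerSeries (Fin M) k) = 1 := by simp [map_pow, constantCoeff_X]
    rw [hcc]
    by_cases hj : j = v
    · rw [if_pos hj, if_pos hj, if_pos hj]; push_cast; ring
    · rw [if_neg hj, if_neg hj, if_neg hj, add_zero]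

/-- The constant coefficient of `(1 + y_v)^w` is `1`. [OURS · L1 W4.3] -/
theorem constantCoeff_one_add_X_pow {M : ℕ} (v : Fin M) (w : ℕ) :
    constantCoeff ((1 + X v) ^ w : MvPowerSeries (Fin M) k) = 1 := by
  simp [map_pow, constantCoeff_X]

/-! ## §4 The tame trivialization at the last coordinate -/

section Tame

variable {n : ℕ} (w : Fin (n + 1) → ℕ) (c : Fin (n + 1) → k)

/-- Identification of the orbit parameter `μ` with the frozen slot `y_v` (`v` = last): `s ↦ s`, `yⱼ ↦ yⱼ`, `μ ↦ y_v`.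
[OURS · L1 W4.3] -/
noncomputable def kappa (n : ℕ) : Fin (n + 1 + 1 + 1) → MvPowerSeries (Fin (n + 1 + 1)) k :=
  Fin.snoc (fun i : Fin (n + 1 + 1) => (X i : MvPowerSeries (Fin (n + 1 + 1)) k)) (X (Fin.last (n + 1)))

/-- `kappa` is substitutable. [OURS · L1 W4.3] -/
theorem hasSubst_kappa (n : ℕ) : HasSubst (kappa (k := k) n) :=
  hasSubst_of_constantCoeff_zero fun i => by
    refine Fin.lastCases ?_ (fun l => ?_) i
    · simp [kappa, constantCoeff_X]
    · simp [kappa, constantCoeff_X]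

/-- THE TRIVIALIZING COORDINATE CHANGE `Λ = sliceL` read through `μ ↦ y_v`:
`Λ = (s, ((1+y_v)^{wⱼ}(cⱼ + yⱼ) − cⱼ)_{j ≠ v}, c_v((1+y_v)^{w_v} − 1))`. [OURS · L1 W4.3] -/
noncomputable def tameLambda : Fin (n + 1 + 1) → MvPowerSeries (Fin (n + 1 + 1)) k :=
  fun i => subst (kappa n) (sliceL w c (Fin.last n) i)

/-- `Λ(s) = s`. [OURS · L1 W4.3] -/
theorem tameLambda_zero : tameLambda w c 0 = X 0 := by
  have hκ := hasSubst_kappa (k := k) n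
  unfold tameLambda sliceL
  rw [Matrix.cons_val_zero, subst_X hκ]
  simp [kappa, Fin.snoc]
  rfl

/-- `Λ(yⱼ)`. [OURS · L1 W4.3] -/
theorem tameLambda_succ (j : Fin (n + 1)) :
    tameLambda w c j.succ = if j = Fin.last n then (1 + X (Fin.last (n + 1))) ^ (w j) * C (c j) - C (c j)
      else (1 + X (Fin.last (n + 1))) ^ (w j) * (C (c j) + X j.succ) - C (c j) := by
  have hκ := hasSubst_kappa (k := k) n
  have hlast : kappa (k := k) n (Fin.last (n + 1 + 1)) = X (Fin.last (n + 1)) := by simp [kappa]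
  have hcs : ∀ i : Fin (n + 1 + 1), kappa (k := k) n (Fin.castSucc i) = X i := by intro i; simp [kappa]
  unfold tameLambda sliceL
  rw [Matrix.cons_val_succ]
  by_cases hj : j = Fin.last n
  · rw [if_pos hj, if_pos hj, subst_sub hκ, subst_mul hκ, subst_pow hκ, subst_add hκ, subst_C, subst_X hκ,
      ← coe_substAlgHom hκ, map_one, hlast]
  · rw [if_neg hj, if_neg hj, subst_sub hκ, subst_mul hκ, subst_pow hκ, subst_add hκ, subst_add hκ, subst_C,
      subst_X hκ, subst_X hκ, ← coe_substAlgHom hκ, map_one, hlast, hcs]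

end Tame

section TameProps

variable {n : ℕ} (w : Fin (n + 1) → ℕ) (c : Fin (n + 1) → k)

/-- `Λ` has zero constant terms. [OURS · L1 W4.3] -/
theorem constantCoeff_tameLambda (i : Fin (n + 1 + 1)) : constantCoeff (tameLambda w c i) = 0 := by
  refine Fin.cases ?_ (fun j => ?_) i
  · rw [tameLambda_zero]; exact constantCoeff_X 0
  · rw [tameLambda_succ]
    split_ifs <;> simp [constantCoeff_X]

/-- Monomials of a difference. [OURS · L1 W4.3] -/
theorem coeff_ne_zero_or_of_sub {M : ℕ} {φ ψ : MvPowerSeries (Fin M) k} {e : Fin M →₀ ℕ} (h : coeff e (φ - ψ) ≠ 0) :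
    coeff e φ ≠ 0 ∨ coeff e ψ ≠ 0 := by
  by_contra hc
  push Not at hc
  apply h
  rw [map_sub, hc.1, hc.2, sub_zero]

/-- `(1 + y_L)^w` has degree `0` for any lattice containing `e_L`. [OURS · L1 W4.3] -/
theorem homDeg_one_add_X_pow {M : ℕ} (Lt : AddSubgroup (Fin M → ℤ)) (v : Fin M) (hv : (Pi.single v 1 : Fin M → ℤ) ∈ Lt)
    (m : ℕ) : ∀ d, coeff d ((1 + X v) ^ m : MvPowerSeries (Fin M) k) ≠ 0 → expVec d - 0 ∈ Lt := by
  intro d hd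
  obtain ⟨t, rfl⟩ := exists_eq_single_of_coeff_one_add_X_pow v m d hd
  rw [expVec_single, sub_zero]
  have : (Pi.single v (t : ℤ) : Fin M → ℤ) = t • (Pi.single v 1 : Fin M → ℤ) := by
    funext x
    by_cases hx : x = v
    · subst hx; simp
    · simp [hx]
  rw [this]
  exact Lt.nsmul_mem hv t

/-- A variable has the degree of its unit vector. [OURS · L1 W4.3] -/
theorem homDeg_X {M : ℕ} (Lt : AddSubgroup (Fin M → ℤ)) (i : Fin M) :
    ∀ d, coeff d (X i : MvPowerSeries (Fin M) k) ≠ 0 → expVec d - Pi.single i 1 ∈ Lt := by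
  intro d hd
  rw [coeff_X] at hd
  have : d = Finsupp.single i 1 := by by_contra hne; exact hd (if_neg hne)
  subst this
  rw [expVec_single, Nat.cast_one, sub_self]
  exact Lt.zero_mem

/-- `c + y_i` has degree `0` when `e_i ∈ Lt`. [OURS · L1 W4.3] -/
theorem homDeg_C_add_X {M : ℕ} (Lt : AddSubgroup (Fin M → ℤ)) (i : Fin M) (hi : (Pi.single i 1 : Fin M → ℤ) ∈ Lt) (r : k) :
    ∀ d, coeff d (C r + X i : MvPowerSeries (Fin M) k) ≠ 0 → expVec d - 0 ∈ Lt := by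
  intro d hd
  rw [map_add, coeff_C, coeff_X] at hd
  by_cases h0 : d = 0
  · subst h0; rw [expVec_zero, sub_zero]; exact Lt.zero_mem
  · by_cases h1 : d = Finsupp.single i 1
    · subst h1; rw [expVec_single, Nat.cast_one, sub_zero]; exact hi
    · rw [if_neg h0, if_neg h1, add_zero] at hd; exact absurd rfl hd

/-- **`Λ` IS GRADED** for every lattice containing `e_L` (the frozen coordinate) and the unit vectors `e_{yⱼ}` of the
translated coordinates (`cⱼ ≠ 0 < wⱼ`) — in particular for the propagated lattice `succLattice L w c` when `c_v ≠ 0 < w_v`.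
[OURS · L1 W4.3] -/
theorem tameLambda_graded (Lt : AddSubgroup (Fin (n + 1 + 1) → ℤ))
    (hlast : (Pi.single (Fin.last (n + 1)) 1 : Fin (n + 1 + 1) → ℤ) ∈ Lt)
    (hgen : ∀ j : Fin (n + 1), c j ≠ 0 → 0 < w j → (Pi.single j.succ 1 : Fin (n + 1 + 1) → ℤ) ∈ Lt)
    (i : Fin (n + 1 + 1)) (e : Fin (n + 1 + 1) →₀ ℕ) (he : coeff e (tameLambda w c i) ≠ 0) :
    expVec e - Pi.single i 1 ∈ Lt := by
  have he0 : e ≠ 0 := by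
    rintro rfl
    exact he (by rw [coeff_zero_eq_constantCoeff_apply]; exact constantCoeff_tameLambda w c i)
  revert he
  refine Fin.cases ?_ (fun j => ?_) i
  · intro he
    rw [tameLambda_zero] at he
    exact homDeg_X Lt 0 e he
  · intro he
    rw [tameLambda_succ] at he
    have hP := homDeg_one_add_X_pow (k := k) Lt (Fin.last (n + 1)) hlast (w j)
    have hCz : coeff e (C (c j) : MvPowerSeries (Fin (n + 1 + 1)) k) = 0 := by rw [coeff_C, if_neg he0]
    by_cases hj : j = Fin.last n
    · rw [if_pos hj] at he
      rcases coeff_ne_zero_or_of_sub he with h1 | h1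
      · rw [coeff_mul_C] at h1
        have hPe : coeff e ((1 + X (Fin.last (n + 1))) ^ (w j) : MvPowerSeries (Fin (n + 1 + 1)) k) ≠ 0 :=
          left_ne_zero_of_mul h1
        have hd := hP e hPe
        have hL : (Pi.single j.succ 1 : Fin (n + 1 + 1) → ℤ) ∈ Lt := by rw [hj, Fin.succ_last]; exact hlast
        have : expVec e - Pi.single j.succ 1 = (expVec e - 0) - Pi.single j.succ 1 := by rw [sub_zero]
        rw [this]
        exact Lt.sub_mem hd hL
      · exact absurd hCz h1
    · rw [if_neg hj] at he
      by_cases hw0 : w j = 0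
      · rw [hw0, pow_zero, one_mul, add_sub_cancel_left] at he
        exact homDeg_X Lt j.succ e he
      · rcases coeff_ne_zero_or_of_sub he with h1 | h1
        · by_cases hcj : c j = 0
          · rw [hcj, map_zero, zero_add] at h1
            have := homDeg_mul Lt hP (homDeg_X Lt j.succ) e h1
            rwa [zero_add] at this
          · have hjs := hgen j hcj (Nat.pos_of_ne_zero hw0)
            have := homDeg_mul Lt hP (homDeg_C_add_X Lt j.succ hjs (c j)) e h1
            rw [add_zero] at this
            have hsplit : expVec e - Pi.single j.succ 1 = (expVec e - 0) - Pi.single j.succ 1 := by rw [sub_zero]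
            rw [hsplit]
            exact Lt.sub_mem this hjs
        · exact absurd hCz h1

/-- Rows of the linear part of `Λ`. [OURS · L1 W4.3] -/
theorem linMat_tameLambda_zero (j : Fin (n + 1 + 1)) : linMat (tameLambda w c) 0 j = if j = 0 then 1 else 0 := by
  show coeff (Finsupp.single j 1) (tameLambda w c 0) = _
  rw [tameLambda_zero, coeff_X]
  by_cases hj : j = 0
  · subst hj; simp
  · rw [if_neg (fun h => hj ((Finsupp.single_left_inj one_ne_zero).mp h)), if_neg hj]

/-- Rows of the linear part of `Λ` (translated coordinates). [OURS · L1 W4.3] -/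
theorem linMat_tameLambda_succ (l : Fin (n + 1)) (hl : l ≠ Fin.last n) (j : Fin (n + 1 + 1)) :
    linMat (tameLambda w c) l.succ j =
      (if j = l.succ then 1 else 0) + (if j = Fin.last (n + 1) then (w l : k) * c l else 0) := by
  show coeff (Finsupp.single j 1) (tameLambda w c l.succ) = _
  rw [tameLambda_succ, if_neg hl, mul_add, add_sub_right_comm, map_add, map_sub, coeff_mul_C, coeff_C,
    if_neg (Finsupp.single_ne_zero.mpr one_ne_zero), sub_zero, coeff_single_one_add_X_pow, mul_comm ((1 + X _) ^ _) (X _),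
    coeff_single_X_mul, constantCoeff_one_add_X_pow]
  by_cases hj : j = Fin.last (n + 1)
  · rw [hj]; split_ifs <;> ring
  · simp [hj]

/-- Row of the frozen coordinate. [OURS · L1 W4.3] -/
theorem linMat_tameLambda_last (j : Fin (n + 1 + 1)) :
    linMat (tameLambda w c) (Fin.last (n + 1)) j = if j = Fin.last (n + 1) then (w (Fin.last n) : k) * c (Fin.last n) else 0 := by
  show coeff (Finsupp.single j 1) (tameLambda w c (Fin.last (n + 1))) = _
  rw [← Fin.succ_last, tameLambda_succ, if_pos rfl, map_sub, coeff_mul_C, coeff_C,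
    if_neg (Finsupp.single_ne_zero.mpr one_ne_zero), sub_zero, coeff_single_one_add_X_pow, Fin.succ_last]
  by_cases hj : j = Fin.last (n + 1)
  · simp [hj]
  · simp [hj]

/-- **THE DETERMINANT OF `Λ` IS `w_v · c_v`** (upper triangular: the frozen coordinate is the last one). [OURS · L1 W4.3] -/
theorem det_linMat_tameLambda : (linMat (tameLambda w c)).det = (w (Fin.last n) : k) * c (Fin.last n) := by
  have htri : Matrix.BlockTriangular (linMat (tameLambda w c)) id := by
    intro i j hij
    simp only [id] at hij
    revert hij
    refine Fin.cases ?_ (fun l => ?_) i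
    · intro hij; exact absurd hij (Fin.not_lt_zero j)
    · intro hij
      by_cases hl : l = Fin.last n
      · subst hl
        rw [Fin.succ_last] at hij ⊢
        rw [linMat_tameLambda_last, if_neg hij.ne]
      · rw [linMat_tameLambda_succ w c l hl, if_neg hij.ne, if_neg, add_zero]
        exact (lt_of_lt_of_le hij (Fin.le_last _)).ne
  rw [Matrix.det_of_upperTriangular htri, Fin.prod_univ_succ, linMat_tameLambda_zero, if_pos rfl, one_mul,
    Fin.prod_univ_castSucc]
  have h1 : ∀ l : Fin n, linMat (tameLambda w c) (Fin.castSucc l).succ (Fin.castSucc l).succ = 1 := by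
    intro l
    rw [linMat_tameLambda_succ w c (Fin.castSucc l) (Fin.castSucc_lt_last l).ne, if_pos rfl, if_neg, add_zero]
    rw [← Fin.succ_last]
    exact fun h => (Fin.castSucc_lt_last l).ne (Fin.succ_injective _ h)
  rw [Finset.prod_eq_one (fun l _ => h1 l), one_mul, Fin.succ_last, linMat_tameLambda_last, if_pos rfl]

end TameProps


end GradedGame

end Summit.ResolutionOfSingularities.ResolutionOfSingularities.Theorems
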